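import Literature.IUT.LogVolume.TensorPacketShellHull
import Literature.IUT.LogVolume.LogVolumeEstimatesFirst
import HarnessLib

/-!
# The hull defect of the log-shell lattice in classical invariants:
# `δ_Λ = Σ_i {log‖z_i^max‖ + (1/e_i + m_i/(e_i f_i))·log p} − log μ̄(R_I)`
# ([IUTchIV] Prop. 1.4 (ii), proof of Prop. 1.4 (iii); Dupuy–Hilado §4.12)

abc-iut cell, prover seat abc-iut-w5-d082 (item XXVIIc-window of `HOME/skel/FORK-REAL-MODEL.md` §4), sequel to
`TensorPacketShellHull` (`H := log μ̄(hull(log_p(R_I^×))) = Σ_i log‖z_i^max‖`) and `TensorPacketContentVolume` (the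
volume-form window for the hull of an (Ind2)-orbit, located at `δ_Λ := H − log μ̄(log_p(R_I^×))`). HERE the second
term is evaluated, so that `δ_Λ` — the only packet invariant left in the window — is a sum of classical per-field
numbers plus the normalisation defect of `R_I = ⊗_{ℤ_p} R_i`:

* `packetLogμ_logPacket_eq_sum_add`: **`log μ̄(log_p(R_I^×)) = Σ_i μ^log_i(log_p(R_i^×)) + log μ̄(R_I)`** in the packet's
  normalised log-measure (the "⊗-lattice identity" of the printed proof of [IUTchIV] Prop. 1.4 (iii), abc-iut-S7's
  `tensorLogVolume_packetOf`, read through the bridge `packetLogμ = tensorLogVolume`, abc-iut-S7/S8);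
* `packetLogμ_logPacket_eq`: with [IUTchIV] Prop. 1.4 (ii) per factor (abc-iut-S8's `prop14ii_holds`:
  `μ^log_i(log_p(R_i^×)) = −{1/e_i + m_i/(e_i f_i)}·log p`, `p^{m_i} = #μ_{p^∞}(k_i)`):
  **`log μ̄(log_p(R_I^×)) = −Σ_i {1/e_i + m_i/(e_i f_i)}·log p + log μ̄(R_I)`**;
* `packetLogμ_packetHull_logPacket_sub_eq`: hence, for any family `z^max` of per-factor norm-maximisers,
  **`δ_Λ = Σ_i {log‖z_i^max‖ + (1/e_i + m_i/(e_i f_i))·log p} − log μ̄(R_I)`** — i.e. `δ_Λ = Σ_i δ_i + (−log μ̄(R_I))`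
  with `δ_i := log‖z_i^max‖ − μ^log_i(log_p(R_i^×))` the hull defect of `log_p(R_i^×)` inside `k_i` and `−log μ̄(R_I) ≥ 0`
  ([IUTchIV] Prop. 1.1; `TensorPacketTameShell.packetLogμ_integerPacket_ge` bounds it by `(d_I − d_*)·log p`);
* `packetLogμ_logPacket_le_neg_sum`: the printed consequence `log μ̄(log_p(R_I^×)) ≤ −(Σ_i 1/e_i)·log p`.

[cite: Mochizuki2012, IUTchIV Prop. 1.4 (ii)(iii) p. 13–14] [cite: DupuyHilado2025, §4.12] Classical; (Ind2)/the hull are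
the tree's typings of disputed-corpus constructions [claim: Mochizuki2012, status: disputed]; nothing here takes a side
on [IUTchIII] Cor. 3.12. PROOF-ONLY file: no definitions, no named `Prop` facts.
-/

noncomputable section

open MeasureTheory Set Module
open scoped Pointwise TensorProduct ENNReal

namespace Literature.IUT.LogVolume

variable (p : ℕ) [Fact p.Prime]
variable {I : Type} [Fintype I] [DecidableEq I] [Nonempty I]
variable (k : I → Type) [∀ i, NontriviallyNormedField (k i)] [∀ i, NormedAlgebra ℚ_[p] (k i)]
  [∀ i, IsUltrametricDist (k i)] [∀ i, ProperSpace (k i)]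

/-- **The ⊗-lattice identity in the packet's log-measure**:
`log μ̄(log_p(R_I^×)) = Σ_i μ^log_i(log_p(R_i^×)) + log μ̄(R_I)`, the per-factor log-volumes normalised by the degrees
`e_i f_i = [k_i : ℚ_p]` (any Borel structure on the `k_i`). [cite: Mochizuki2012, IUTchIV Prop. 1.4 (iii) proof p. 14] -/
theorem packetLogμ_logPacket_eq_sum_add [∀ i, MeasurableSpace (k i)] [∀ i, BorelSpace (k i)] :
    packetLogμ p k (logPacket p k : Set (PacketAlgebra p k)) =
      (∑ i, normalizedLocalLogVolume (k i) (absRamificationIdx p (k i) * residueDegree p (k i)) (logUnits (k i))) +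
        packetLogμ p k (integerPacket p k : Set (PacketAlgebra p k)) := by
  set Λ := integerStructure p k with hΛ
  have hMo : ∀ i, IsOpen ((logUnitsAddSubgroup p (k i) : AddSubgroup (k i)) : Set (k i)) :=
    fun i ↦ isOpen_logUnits p (k i)
  have hMc : ∀ i, IsCompact ((logUnitsAddSubgroup p (k i) : AddSubgroup (k i)) : Set (k i)) :=
    fun i ↦ isCompact_logUnits p (k i)
  have hLpos : 0 < Λ.haar (logPacket p k : Set (PacketAlgebra p k)) := by
    rw [logPacket_eq_packetOf]; exact haar_packetOf_pos p k _ hMo hMc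
  have hLfin : Λ.haar (logPacket p k : Set (PacketAlgebra p k)) < ∞ := by
    rw [logPacket_eq_packetOf]; exact haar_packetOf_lt_top p k _ hMo hMc
  have hRpos : 0 < Λ.haar (integerPacket p k : Set (PacketAlgebra p k)) := by
    rw [hΛ, ← coe_integerStructure, IntegralStructure.haar_self]; exact one_pos
  have hRfin : Λ.haar (integerPacket p k : Set (PacketAlgebra p k)) < ∞ := by
    rw [hΛ, ← coe_integerStructure, IntegralStructure.haar_self]; exact ENNReal.one_lt_top
  rw [packetLogμ_eq_tensorLogVolume p k hLpos hLfin, packetLogμ_eq_tensorLogVolume p k hRpos hRfin]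
  have h := tensorLogVolume_packetOf p k (fun i ↦ logUnitsAddSubgroup p (k i)) hMo hMc
  rw [← logPacket_eq_packetOf] at h
  rw [h]
  congr 1
  refine Finset.sum_congr rfl fun i _ ↦ ?_
  rw [absRamificationIdx_mul_residueDegree p (k i), coe_logUnitsAddSubgroup]

/-- **`log μ̄(log_p(R_I^×)) = −Σ_i {1/e_i + m_i/(e_i f_i)}·log p + log μ̄(R_I)`** (`p^{m_i} = #μ_{p^∞}(k_i)`; [IUTchIV]
Prop. 1.4 (ii) in every factor). [cite: Mochizuki2012, IUTchIV Prop. 1.4 (ii) p. 13, Prop. 1.4 (iii) proof p. 14] -/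
theorem packetLogμ_logPacket_eq :
    packetLogμ p k (logPacket p k : Set (PacketAlgebra p k)) =
      -(∑ i, (1 / (absRamificationIdx p (k i) : ℝ) +
          (torsionPExp p (k i) : ℝ) / ((absRamificationIdx p (k i) : ℝ) * residueDegree p (k i)))) * Real.log p +
        packetLogμ p k (integerPacket p k : Set (PacketAlgebra p k)) := by
  letI : ∀ i, MeasurableSpace (k i) := fun i ↦ borel (k i)
  haveI : ∀ i, BorelSpace (k i) := fun i ↦ ⟨rfl⟩
  rw [packetLogμ_logPacket_eq_sum_add, neg_mul, Finset.sum_mul, ← Finset.sum_neg_distrib]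
  congr 1
  refine Finset.sum_congr rfl fun i _ ↦ ?_
  have h := prop14ii_holds p (k i)
  unfold Prop14ii at h
  rw [h, neg_mul]

/-- The printed consequence: **`log μ̄(log_p(R_I^×)) ≤ −(Σ_i 1/e_i)·log p`** (drop `m_i ≥ 0` and `log μ̄(R_I) ≤ 0`).
[cite: Mochizuki2012, IUTchIV Prop. 1.4 (iii) proof p. 14] -/
theorem packetLogμ_logPacket_le_neg_sum :
    packetLogμ p k (logPacket p k : Set (PacketAlgebra p k)) ≤
      -(∑ i, 1 / (absRamificationIdx p (k i) : ℝ)) * Real.log p := by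
  have hlogp : 0 ≤ Real.log p := Real.log_nonneg (by exact_mod_cast (Fact.out : p.Prime).one_lt.le)
  have hR : packetLogμ p k (integerPacket p k : Set (PacketAlgebra p k)) ≤ 0 := by
    rw [← packetLogμ_normalizedPacket p k]
    exact packetLogμ_mono p k (packetAdm_integerPacket p k) (packetAdm_normalizedPacket p k)
      (integerPacket_le_normalizedPacket p k)
  have hsum : ∑ i, 1 / (absRamificationIdx p (k i) : ℝ) ≤
      ∑ i, (1 / (absRamificationIdx p (k i) : ℝ) +
        (torsionPExp p (k i) : ℝ) / ((absRamificationIdx p (k i) : ℝ) * residueDegree p (k i))) :=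
    Finset.sum_le_sum fun i _ => le_add_of_nonneg_right (by positivity)
  rw [packetLogμ_logPacket_eq]
  nlinarith

/-- **The hull defect in classical invariants**: for any family `z^max` of per-factor norm-maximisers of the
`log_p(R_i^×)`, `δ_Λ = log μ̄(hull(log_p(R_I^×))) − log μ̄(log_p(R_I^×)) =
Σ_i {log‖z_i^max‖ + (1/e_i + m_i/(e_i f_i))·log p} − log μ̄(R_I)`. [cite: DupuyHilado2025, §4.12]
[cite: Mochizuki2012, IUTchIV Prop. 1.4 (ii) p. 13] -/
theorem packetLogμ_packetHull_logPacket_sub_eq {z : Π i, k i} (hzmem : ∀ i, z i ∈ logUnits (k i))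
    (hz : ∀ i, ∀ w ∈ logUnits (k i), ‖w‖ ≤ ‖z i‖) :
    packetLogμ p k (packetHull p k (logPacket p k : Set (PacketAlgebra p k))) -
        packetLogμ p k (logPacket p k : Set (PacketAlgebra p k)) =
      (∑ i, (Real.log ‖z i‖ + (1 / (absRamificationIdx p (k i) : ℝ) +
          (torsionPExp p (k i) : ℝ) / ((absRamificationIdx p (k i) : ℝ) * residueDegree p (k i))) * Real.log p)) -
        packetLogμ p k (integerPacket p k : Set (PacketAlgebra p k)) := by
  have hsplit : ∑ i, (Real.log ‖z i‖ + (1 / (absRamificationIdx p (k i) : ℝ) +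
      (torsionPExp p (k i) : ℝ) / ((absRamificationIdx p (k i) : ℝ) * residueDegree p (k i))) * Real.log p) =
      ∑ i, Real.log ‖z i‖ + (∑ i, (1 / (absRamificationIdx p (k i) : ℝ) +
        (torsionPExp p (k i) : ℝ) / ((absRamificationIdx p (k i) : ℝ) * residueDegree p (k i)))) * Real.log p := by
    rw [Finset.sum_add_distrib, Finset.sum_mul]
  rw [packetLogμ_packetHull_logPacket_eq_sum p k hzmem hz, packetLogμ_logPacket_eq, hsplit]
  ring

/-- The same with the normalisation defect on the left: `δ_Λ + log μ̄(R_I) = Σ_i {log‖z_i^max‖ +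
(1/e_i + m_i/(e_i f_i))·log p}` — the part of the hull defect carried by the individual factors.
[cite: DupuyHilado2025, §4.12] [cite: Mochizuki2012, IUTchIV Prop. 1.4 (ii) p. 13] -/
theorem packetLogμ_packetHull_logPacket_sub_add_eq_sum {z : Π i, k i} (hzmem : ∀ i, z i ∈ logUnits (k i))
    (hz : ∀ i, ∀ w ∈ logUnits (k i), ‖w‖ ≤ ‖z i‖) :
    packetLogμ p k (packetHull p k (logPacket p k : Set (PacketAlgebra p k))) -
          packetLogμ p k (logPacket p k : Set (PacketAlgebra p k)) +
        packetLogμ p k (integerPacket p k : Set (PacketAlgebra p k)) =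
      ∑ i, (Real.log ‖z i‖ + (1 / (absRamificationIdx p (k i) : ℝ) +
        (torsionPExp p (k i) : ℝ) / ((absRamificationIdx p (k i) : ℝ) * residueDegree p (k i))) * Real.log p) := by
  rw [packetLogμ_packetHull_logPacket_sub_eq p k hzmem hz]
  ring

end Literature.IUT.LogVolume

end
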